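import Literature.MeasureTheory.Integral.HomogeneousVertexIntegrability                  -- ★ (D3v) + ED. 2 p852122: `setLIntegral_pi_primePowBall_lt_top_of_homogeneous`
import Literature.MeasureTheory.Group.LocFiniteLIntegralProductTransfer                   -- ★ (G-FUB) p852081: `exists_nhds_setLIntegral_lt_top_iff_of_addEquiv`
import Summits.HodgeConjecture.HodgeConjecture.Theorems.F0P3cStCharTSHCDCoordinatesSlice  -- ★ (CO) FILE 2 (F0P2-p06): `exists_coords_slice` (Φ_S, weights (2,3,3,4))
import Summits.HodgeConjecture.HodgeConjecture.Theorems.F0P3cStCharTSHCDLieGlobal         -- ★ (ASM) p852131 (F0P3a-p07): `sqrt_sqrt_normAbs_discr_smul`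
import Literature.LinearAlgebra.Matrix.CubicCharpolyDiscrNonRegular                       -- ★ (C) p852036: `nonregular_trichotomy`, `discr_*`
import Literature.LinearAlgebra.Matrix.CubicChevalleyDifferential                         -- ★ (D4a FILE 1) (LH1-p03): `exists_mul_sub_eq_zero_iff_not_linearIndependent`
import Literature.LinearAlgebra.Matrix.UnitaryThreeMinimalNilpotentWitt                   -- ★ (E) p852074 (F0P3-p02): `single_zero_two_mem_iff`
import Literature.NumberTheory.LocalFields.FiniteEmbeddingNormAbs                         -- ★ (NB) p852113: `normAbs_map_eq_sq_of_involution`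
import HarnessLib

/-!
# F0 · P3c · line LH6 «StCharTS» — ROAD «HC-D» brick D5(iii), FILE B «SLODOWY SLICE — VERTEX, CLASSIFICATION AND ASSEMBLY AT A MINIMAL NILPOTENT»
# (Harish-Chandra 1970 VII §1 Thm. 15 for `U(3)` by Slodowy slices; Slodowy 1980 §7.4; Tate 1950 §2.4)

Cell `pub/hodgecm-mathlib`, crux H413 = `stmt-HodgeConjecture-24833` (lane `--supports`, helper); seat A-p12 (g29); brick D5(iii) of the ROAD «HC-D» (holder F0P2-p01
(g23); CENSUS-HCD v1 §1 (iii); WORDS #6∕#7∕#9).  THEOREMS ONLY; sorry-free; no definition ∕ instance ∕ notation ∕ named fact; axioms TRIO.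

THE MATHEMATICS (census §1 (iii)).  `K ⊃ ι F′` a quadratic extension of non-archimedean local fields with involution `σ` (`K^σ = ι F′`), `J₃ = antidiag(1,1,1)`,
`𝔲₀ = {X ∈ M₃(K) | ᵗ(σX)J₃ + J₃X = 0, tr X = 0}` with an additive Haar measure `μ₀`, the integrand `ηι X = |disc χ_X|_K^{−1∕4}` (R2 token, `= ⊤` on the discriminant
locus).  At the minimal nilpotent `N = c·E₀₂` (`σ c = −c`, `c ≠ 0`) the SLODOWY SLICE is `N + C`, `C = 𝔲₀ ∩ 𝔷(E₂₀)` (`F′`-dimension `4`, ★ (CO) `Φ_S : (Fin 4 → F′) ≃ₜ+ ↥C`),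
stable under the contraction `ρ_s Z = (ι s)² · diag((ι s)⁻¹, 1, ι s) Z diag(ι s, 1, (ι s)⁻¹)` which FIXES `N` and has weights `(2,3,3,4)` in the coordinates `Φ_S`;
`ηι (N + ρ_ϖ Z) = q⁶ · ηι (N + Z)` (`disc χ` is conjugation invariant and homogeneous of degree `6`; `|ι ϖ|_K = q⁻²` by ★ (NB)), while `ρ_ϖ` contracts Haar
measure on `C` by `q⁻¹²`: `q⁶ · q⁻¹² < 1`, so ★ (D3v) ED. 2's LOCAL vertex engine applies on `C` (§1–§3).  Every slice point `N + Z`, `Z ≠ 0`, is either regular or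
semisimple of type `(a,a,b)` (★ (D) ED. 3, §4), hence covered by the road's local theorems (i) and (ii); the slice identities DOWN∕UP (FILE `…HCDSlodowySliceChart`,
the descended Cayley chart `(Y, Z) ↦ c(Y)(N + Z)c(Y)⁻¹`) move finiteness between `𝔲₀` and `C`; §5 assembles, §6 transports to every rank-one square-zero `X₀ ∈ 𝔲₀` by
Witt (★ (E)) and `Ad(g)` (★ (AD)).

HONEST LABEL: count-neutral; closes no organ.  HC_CM is proved only modulo the 7 printed citations (2 remaining: hLiu418 = `stmt-HodgeConjecture-24832`, h413 =
`stmt-HodgeConjecture-24833`) until rung 0 closes.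

## References
* [HarishChandra1970] Harish-Chandra (notes by G. van Dijk), *Harmonic analysis on reductive p-adic groups*, LNM 162 (1970), Part VII §1 Thm. 15; Part V §4 Lemma 22.
* [Slodowy1980] P. Slodowy, *Simple Singularities and Simple Algebraic Groups*, LNM 815 (1980), §7.4.
* [Tate1950] J. Tate, *Fourier analysis in number fields and Hecke's zeta-functions* (1950), §2.4.
* [Rogawski1990] J. D. Rogawski, *Automorphic Representations of Unitary Groups in Three Variables*, Ann. of Math. Stud. 123 (1990), §4.9 p. 54 (`D_G`), §12.5 p. 182.
-/

set_option autoImplicit false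
-- the mandated namespace has the single-problem summit's repeated segment (`HodgeConjecture.HodgeConjecture`)
set_option linter.dupNamespace false

noncomputable section

open MeasureTheory MeasureTheory.Measure Set Filter Topology Matrix
open scoped ENNReal NNReal Pointwise
open Literature.NumberTheory.GaloisRepresentations.IsNonarchimedeanLocalField
open Literature.NumberTheory.Automorphic Literature.NumberTheory.Automorphic.LocalFieldHaar
open Literature.MeasureTheory.Integral Literature.MeasureTheory.Group Literature.LinearAlgebra.Matrix
open Summit.HodgeConjecture.HodgeConjecture.Cruxes.H413.F0P3cStCharTSHCDCoordinates
open Summit.HodgeConjecture.HodgeConjecture.Cruxes.H413.F0P3cStCharTSHCDLieGlobal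

namespace Summit.HodgeConjecture.HodgeConjecture.Cruxes.H413.F0P3cStCharTSHCDSlodowySliceAssembly

/-! ## §1 The local weighted-homogeneous vertex lemma, neighbourhood form -/

section Vertex
variable {F : Type*} [Field F] [ValuativeRel F] [TopologicalSpace F] [IsNonarchimedeanLocalField F]
  [MeasurableSpace F] [BorelSpace F] {ι : Type*} [Fintype ι] [Nonempty ι]

omit [MeasurableSpace F] [BorelSpace F] [Nonempty ι] in
/-- A neighbourhood of `0` in `ι → F` contains a box `∏ 𝔭^m` (★ `exists_primePowBall_subset_of_mem_nhds_zero` coordinatewise). [cite: Tate1950, §2.4] -/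
theorem exists_pi_primePowBall_subset {U₀ : Set (ι → F)} (hU₀ : U₀ ∈ 𝓝 (0 : ι → F)) :
    ∃ m : ℕ, Set.pi univ (fun _ : ι => primePowBall F (m : ℤ)) ⊆ U₀ := by
  rw [nhds_pi, Filter.mem_pi'] at hU₀
  obtain ⟨I, t, ht, hsub⟩ := hU₀
  have hn : ∀ i, ∃ n : ℕ, primePowBall F (n : ℤ) ⊆ t i := fun i =>
    exists_primePowBall_subset_of_mem_nhds_zero (by simpa using ht i)
  choose n hn using hn
  refine ⟨Finset.univ.sup n, fun x hx => hsub fun i _ => hn i (primePowBall_antitone ?_ (hx i (mem_univ _)))⟩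
  exact_mod_cast Finset.le_sup (Finset.mem_univ i)

/-- **LOCAL VERTEX LEMMA ON `ι → F`, NEIGHBOURHOOD FORM** (over ★ (D3v) ED. 2 `setLIntegral_pi_primePowBall_lt_top_of_homogeneous`): scalars `aᵢ` with
`‖aᵢ‖_F = (q⁻¹)^{kᵢ}`, `kᵢ ≥ 1`; `f ≥ 0` with `f (aᵢxᵢ)ᵢ ≤ c · f x` on `U₀ ∖ {0}` and finite near every `y ∈ U₀ ∖ {0}`, `U₀ ∈ 𝓝 0`, `c < q^{Σ k}` ⇒ `f` is finite near `0`
(choose a box `∏ 𝔭^m ⊆ U₀`; it is an open neighbourhood of `0`). [cite: Tate1950, §2.4] [cite: Slodowy1980, §7.4] -/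
theorem exists_nhds_setLIntegral_lt_top_of_homogeneous_pi_nhds (μ : Measure (ι → F)) [μ.IsAddHaarMeasure]
    (a : ι → F) (k : ι → ℕ) (hk : ∀ i, 1 ≤ k i) (ha : ∀ i, normAbs F (a i) = ((residueFieldCard F : ℝ≥0)⁻¹) ^ k i)
    (f : (ι → F) → ℝ≥0∞) (c : ℝ≥0∞) (hc : c < (residueFieldCard F : ℝ≥0∞) ^ (∑ i, k i))
    {U₀ : Set (ι → F)} (hU₀ : U₀ ∈ 𝓝 (0 : ι → F))
    (hhom : ∀ x ∈ U₀, x ≠ 0 → f (fun i => a i * x i) ≤ c * f x)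
    (hoff : ∀ y ∈ U₀, y ≠ 0 → ∃ U ∈ 𝓝 y, ∫⁻ x in U, f x ∂μ < ∞) :
    ∃ U ∈ 𝓝 (0 : ι → F), ∫⁻ x in U, f x ∂μ < ∞ := by
  obtain ⟨m, hm⟩ := exists_pi_primePowBall_subset (F := F) (ι := ι) hU₀
  refine ⟨Set.pi univ (fun _ : ι => primePowBall F (m : ℤ)),
    (isOpen_set_pi finite_univ fun _ _ => isOpen_primePowBall _).mem_nhds fun i _ => zero_mem_primePowBall _, ?_⟩
  exact setLIntegral_pi_primePowBall_lt_top_of_homogeneous μ a k hk ha (fun _ => (m : ℤ)) f c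
    (fun x hx hx0 => hhom x (hm hx) hx0) hc (fun y hy hy0 => hoff y (hm hy) hy0)

end Vertex

/-! ## §2 The slice assembly (pure logic) -/

section Logic
variable {V C : Type*} [TopologicalSpace V] [MeasurableSpace V] [TopologicalSpace C] [MeasurableSpace C]

/-- **SLICE ASSEMBLY.**  `s : C → V` the slice embedding with vertex `s z₀`, `f ≥ 0` on `V`, measures `μ`, `μC`, `W ∋ z₀` a neighbourhood in `C`.  IF (VERTEX)
finiteness of `f ∘ s` near every `z ∈ W ∖ {z₀}` gives finiteness of `f ∘ s` near `z₀`, (DOWN) at every `z ∈ W ∖ {z₀}` ambient finiteness of `f` near `s z` gives slice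
finiteness of `f ∘ s` near `z`, (UP) slice finiteness near `z₀` gives ambient finiteness near `s z₀`, and (GOOD) `f` is finite near `s z` for every `z ∈ W ∖ {z₀}`,
THEN `f` is finite near the vertex `s z₀`. [cite: HarishChandra1970, Part V §4 Lemma 22; Part VII §1 Thm. 15] [cite: Slodowy1980, §7.4] -/
theorem exists_nhds_setLIntegral_lt_top_of_slice (μ : Measure V) (μC : Measure C) (f : V → ℝ≥0∞) (s : C → V) (z₀ : C)
    (W : Set C)
    (hvertex : (∀ z ∈ W, z ≠ z₀ → ∃ U ∈ 𝓝 z, ∫⁻ x in U, f (s x) ∂μC < ∞) → ∃ U ∈ 𝓝 z₀, ∫⁻ x in U, f (s x) ∂μC < ∞)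
    (hdown : ∀ z ∈ W, z ≠ z₀ → (∃ U ∈ 𝓝 (s z), ∫⁻ x in U, f x ∂μ < ∞) → ∃ U ∈ 𝓝 z, ∫⁻ x in U, f (s x) ∂μC < ∞)
    (hup : (∃ U ∈ 𝓝 z₀, ∫⁻ x in U, f (s x) ∂μC < ∞) → ∃ U ∈ 𝓝 (s z₀), ∫⁻ x in U, f x ∂μ < ∞)
    (hgood : ∀ z ∈ W, z ≠ z₀ → ∃ U ∈ 𝓝 (s z), ∫⁻ x in U, f x ∂μ < ∞) :
    ∃ U ∈ 𝓝 (s z₀), ∫⁻ x in U, f x ∂μ < ∞ :=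
  hup (hvertex fun z hz hz₀ => hdown z hz hz₀ (hgood z hz hz₀))

end Logic

/-! ## §3 The vertex on the Slodowy slice `C = 𝔲₀ ∩ 𝔷(E₂₀)` -/

section SliceVertex

variable {K : Type*} [Field K] [ValuativeRel K] [TopologicalSpace K] [IsNonarchimedeanLocalField K]
  (σ : K →+* K) (hσ : ∀ x, σ (σ x) = x) [Invertible (2 : K)]
  {F' : Type*} [Field F'] [ValuativeRel F'] [TopologicalSpace F'] [IsNonarchimedeanLocalField F']
  (ι : F' →+* K) (hι : IsClosedEmbedding ι) (hιr : ∀ x, σ x = x ↔ x ∈ Set.range ι)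
  (lam : Kˣ) (hlam : σ lam = -lam)

omit [Invertible (2 : K)] in
/-- **Homogeneity of `ηι` under the contracting torus through the slice chart**: with `P = diag((ι s)⁻¹, 1, ι s)`, `Q = diag(ι s, 1, (ι s)⁻¹)` (`Q P = 1`) and
`t = (ι s)²`, `√√|disc χ_{t • (P M Q)}|_K = |ι s|_K³ · √√|disc χ_M|_K` (★ (ASM) `sqrt_sqrt_normAbs_discr_smul` + `charpoly (P M Q) = charpoly M`).
[cite: Rogawski1990, §4.9 p. 54] -/
theorem sqrt_sqrt_normAbs_discr_torus (s : K) (hs : s ≠ 0) (M : Matrix (Fin 3) (Fin 3) K) :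
    NNReal.sqrt (NNReal.sqrt (normAbs K (Matrix.charpoly ((s ^ 2) • (Matrix.diagonal ![s⁻¹, 1, s] * M * Matrix.diagonal ![s, 1, s⁻¹]))).discr)) =
      normAbs K s ^ 3 * NNReal.sqrt (NNReal.sqrt (normAbs K (Matrix.charpoly M).discr)) := by
  have hQP : Matrix.diagonal ![s, 1, s⁻¹] * Matrix.diagonal ![s⁻¹, 1, s] = 1 := by
    rw [Matrix.diagonal_mul_diagonal, ← Matrix.diagonal_one]
    congr 1
    funext i
    fin_cases i <;> simp [hs]
  have hchar : Matrix.charpoly (Matrix.diagonal ![s⁻¹, 1, s] * M * Matrix.diagonal ![s, 1, s⁻¹]) = Matrix.charpoly M := by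
    rw [Matrix.mul_assoc, Matrix.charpoly_mul_comm, Matrix.mul_assoc, hQP, Matrix.mul_one]
  rw [sqrt_sqrt_normAbs_discr_smul (s ^ 2) (normAbs K s) (by rw [map_pow]) _, hchar]

set_option maxHeartbeats 800000 in
-- the slice-chart entry clauses and the `Fin 4 → F′` coordinate transport make elaboration long, not deep
include hσ ι hι hιr lam hlam in
/-- **THE VERTEX ON THE SLODOWY SLICE.**  `C = 𝔲₀ ∩ 𝔷(E₂₀)` (membership clause `hC` as ★ (CO) prints it, `J = J₃`), `μC` ANY additive Haar measure on `↥C`,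
`N = c·E₀₂` (`c ≠ 0`), `F Z := ηι (N + Z)`.  IF `F` has finite integral near every `Z ≠ 0` of some neighbourhood `W` of `0` in `↥C`, THEN near `0` too.
Proof: in the coordinates ★ (CO) `Φ_S : (Fin 4 → F′) ≃ₜ+ ↥C` the contraction `ρ_ϖ` is the dilation `(ϖ², ϖ³, ϖ³, ϖ⁴)` (Haar modulus `q⁻¹²`), it fixes `N`
(★ (D) `torus_conj_single_zero_two`) and `F ∘ ρ_ϖ = q⁶ · F` (`sqrt_sqrt_normAbs_discr_torus` + ★ (NB) `|ι ϖ|_K = q⁻²`); `q⁶ < q¹²`, so §1 applies on `Fin 4 → F′`,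
and ★ (G-FUB) moves local finiteness along `Φ_S` both ways. [cite: HarishChandra1970, Part VII §1 Thm. 15] [cite: Slodowy1980, §7.4] [cite: Tate1950, §2.4] -/
theorem exists_nhds_zero_setLIntegral_lt_top_slice
    {J : Matrix (Fin 3) (Fin 3) K} (hJ : J = !![0, 0, 1; 0, 1, 0; 1, 0, 0]) (c : K)
    (C : AddSubgroup (Matrix (Fin 3) (Fin 3) K))
    (hC : ∀ X, X ∈ C ↔ ((X.map σ)ᵀ * J + J * X = 0 ∧ Matrix.trace X = 0) ∧
      X * Matrix.single (2 : Fin 3) (0 : Fin 3) (1 : K) = Matrix.single (2 : Fin 3) (0 : Fin 3) 1 * X)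
    [MeasurableSpace ↥C] [BorelSpace ↥C] (μC : Measure ↥C) [μC.IsAddHaarMeasure]
    {W : Set ↥C} (hW : W ∈ 𝓝 (0 : ↥C))
    (hgood : ∀ Z ∈ W, Z ≠ 0 → ∃ U ∈ 𝓝 Z, ∫⁻ Z' in U,
      ((NNReal.sqrt (NNReal.sqrt (normAbs K (Matrix.charpoly (Matrix.single (0 : Fin 3) (2 : Fin 3) c + (Z' : Matrix (Fin 3) (Fin 3) K))).discr)) : ℝ≥0∞))⁻¹ ∂μC < ∞) :
    ∃ U ∈ 𝓝 (0 : ↥C), ∫⁻ Z in U,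
      ((NNReal.sqrt (NNReal.sqrt (normAbs K (Matrix.charpoly (Matrix.single (0 : Fin 3) (2 : Fin 3) c + (Z : Matrix (Fin 3) (Fin 3) K))).discr)) : ℝ≥0∞))⁻¹ ∂μC < ∞ := by
  classical
  -- the slice chart
  obtain ⟨Φ, -, -, hΦw⟩ := exists_coords_slice σ hσ hJ ι hι hιr lam hlam C hC
  -- instances on the coordinate space `Fin 4 → F′` and on `↥C`
  haveI : T2Space F' := (Literature.NumberTheory.GaloisRepresentations.IsNonarchimedeanLocalField.isLocalField F').toT2Space
  haveI := secondCountableTopology_localField F'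
  letI : MeasurableSpace F' := borel F'
  haveI : BorelSpace F' := ⟨rfl⟩
  haveI : LocallyCompactSpace ↥C := Φ.toHomeomorph.symm.isClosedEmbedding.locallyCompactSpace
  haveI : SecondCountableTopology ↥C := Φ.toHomeomorph.symm.secondCountableTopology
  set ν : Measure (Fin 4 → F') := Measure.addHaar with hν
  -- the integrand on the slice and in coordinates
  set F : ↥C → ℝ≥0∞ := fun Z =>
    ((NNReal.sqrt (NNReal.sqrt (normAbs K (Matrix.charpoly (Matrix.single (0 : Fin 3) (2 : Fin 3) c + (Z : Matrix (Fin 3) (Fin 3) K))).discr)) : ℝ≥0∞))⁻¹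
    with hFdef
  -- a uniformizer of `F′`, the weights and the constants
  obtain ⟨ϖ, hϖ0, hϖ⟩ := exists_normAbs_eq_inv (F := F')
  have hιϖ0 : ι ϖ ≠ 0 := (map_ne_zero ι).2 hϖ0
  set q : ℝ≥0 := (residueFieldCard F' : ℝ≥0) with hqdef
  have hq1n : 1 < residueFieldCard F' := one_lt_residueFieldCard F'
  have hq1 : 1 < q := by rw [hqdef]; exact_mod_cast hq1n
  have hq0 : q ≠ 0 := (zero_lt_one.trans hq1).ne'
  have hqc : (q : ℝ≥0∞) = ((residueFieldCard F' : ℕ) : ℝ≥0∞) := by rw [hqdef, ENNReal.coe_natCast]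
  have hιn : normAbs K (ι ϖ) = q⁻¹ ^ 2 := by
    rw [Literature.NumberTheory.LocalFields.normAbs_map_eq_sq_of_involution ι hι.continuous σ hσ hιr lam hlam ϖ, hϖ]
  set a : Fin 4 → F' := ![ϖ ^ 2, ϖ ^ 3, ϖ ^ 3, ϖ ^ 4] with hadef
  set k : Fin 4 → ℕ := ![2, 3, 3, 4] with hkdef
  have hk : ∀ i, 1 ≤ k i := fun i => by fin_cases i <;> simp [hkdef]
  have ha : ∀ i, normAbs F' (a i) = ((residueFieldCard F' : ℝ≥0)⁻¹) ^ k i := fun i => by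
    fin_cases i <;> simp [hadef, hkdef, map_pow, hϖ, hqdef]
  have hsum : (∑ i, k i) = 12 := by simp [hkdef, Fin.sum_univ_four]
  have hc : ((residueFieldCard F' : ℕ) : ℝ≥0∞) ^ 6 < (residueFieldCard F' : ℝ≥0∞) ^ (∑ i, k i) := by
    rw [hsum]
    exact_mod_cast Nat.pow_lt_pow_right hq1n (by norm_num)
  -- the contraction fixes `N` and acts on the slice through the weights
  have hN : ((ι ϖ) ^ 2) • (Matrix.diagonal ![(ι ϖ)⁻¹, 1, ι ϖ] * Matrix.single (0 : Fin 3) (2 : Fin 3) c * Matrix.diagonal ![ι ϖ, 1, (ι ϖ)⁻¹]) =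
      Matrix.single (0 : Fin 3) (2 : Fin 3) c := by
    have h := torus_conj_single_zero_two (Units.mk0 (ι ϖ) hιϖ0) c
    simpa only [Units.val_mk0, Units.val_inv_eq_inv_val] using h
  -- homogeneity in coordinates: `F (Φ (a • x)) = q⁶ · F (Φ x)`
  have hhom : ∀ x : Fin 4 → F', x ∈ Φ ⁻¹' W → x ≠ 0 →
      F (Φ (fun i => a i * x i)) ≤ ((residueFieldCard F' : ℕ) : ℝ≥0∞) ^ 6 * F (Φ x) := by
    intro x _ _
    have hax : (fun i => a i * x i) = ![ϖ ^ 2 * x 0, ϖ ^ 3 * x 1, ϖ ^ 3 * x 2, ϖ ^ 4 * x 3] := by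
      funext i; fin_cases i <;> simp [hadef]
    have hmat : Matrix.single (0 : Fin 3) (2 : Fin 3) c + ((Φ (fun i => a i * x i) : ↥C) : Matrix (Fin 3) (Fin 3) K) =
        ((ι ϖ) ^ 2) • (Matrix.diagonal ![(ι ϖ)⁻¹, 1, ι ϖ] * (Matrix.single (0 : Fin 3) (2 : Fin 3) c + ((Φ x : ↥C) : Matrix (Fin 3) (Fin 3) K)) *
          Matrix.diagonal ![ι ϖ, 1, (ι ϖ)⁻¹]) := by
      rw [hax, ← hΦw ϖ hϖ0 x, Matrix.mul_add, Matrix.add_mul, smul_add, hN]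
    apply le_of_eq
    simp only [hFdef]
    rw [hmat, sqrt_sqrt_normAbs_discr_torus (ι ϖ) hιϖ0, hιn, ← hqc]
    have hr0 : (((q⁻¹ ^ 2) ^ 3 : ℝ≥0) : ℝ≥0∞) ≠ 0 := by exact_mod_cast pow_ne_zero 3 (pow_ne_zero 2 (inv_ne_zero hq0))
    rw [ENNReal.coe_mul, ENNReal.mul_inv (Or.inl hr0) (Or.inl ENNReal.coe_ne_top), ← pow_mul, ENNReal.coe_pow, ENNReal.coe_inv hq0,
      ENNReal.inv_pow, inv_inv]
  -- off-zero finiteness in coordinates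
  have hΦc : Continuous (fun x : Fin 4 → F' => Φ x) := Φ.continuous
  have hW0 : W ∈ 𝓝 (Φ 0) := by rw [map_zero]; exact hW
  have hU₀ : Φ ⁻¹' W ∈ 𝓝 (0 : Fin 4 → F') := hΦc.continuousAt.preimage_mem_nhds hW0
  have hoff : ∀ y ∈ Φ ⁻¹' W, y ≠ 0 → ∃ U ∈ 𝓝 y, ∫⁻ x in U, F (Φ x) ∂ν < ∞ := by
    intro y hy hy0
    have hΦy : Φ y ≠ 0 := fun h => hy0 (Φ.injective (by rw [h, map_zero]))
    exact (exists_nhds_setLIntegral_lt_top_iff_of_addEquiv Φ ν μC F y).1 (hgood (Φ y) hy hΦy)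
  -- §1 on the coordinate space, then back to `↥C`
  have h0 := exists_nhds_setLIntegral_lt_top_of_homogeneous_pi_nhds ν a k hk ha (fun x => F (Φ x))
    (((residueFieldCard F' : ℕ) : ℝ≥0∞) ^ 6) hc hU₀ hhom hoff
  have h := (exists_nhds_setLIntegral_lt_top_iff_of_addEquiv Φ ν μC F 0).2 h0
  rwa [map_zero] at h

end SliceVertex

/-! ## §4 Classification of the slice points off the vertex -/

section Classification

variable {K : Type*} [Field K]

/-- **EVERY SLICE POINT OFF THE VERTEX IS REGULAR OR SEMISIMPLE OF TYPE `(a,a,b)`**: for `Z ∈ 𝔷(E₂₀)`, `Z ≠ 0`, trace-free `N + Z` (`N = c·E₀₂`, `c ≠ 0`; `2, 3 ≠ 0`),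
either `1, X, X²` are linearly independent (`X = N + Z` regular, ★ D4a's R5 token) or `(X − a•1)(X − b•1) = 0` with `a ≠ b` and `X` non-scalar (★ (D) ED. 3
`ne_and_not_scalar_of_slice_nonregular` on ★ D4a `exists_mul_sub_eq_zero_iff_not_linearIndependent`). [cite: HarishChandra1970, Part VII §1 Thm. 15] [cite: Slodowy1980, §7.4] -/
theorem slice_point_regular_or_type_aab {c : K} (hc : c ≠ 0) (h2 : (2 : K) ≠ 0) (h3 : (3 : K) ≠ 0) {Z : Matrix (Fin 3) (Fin 3) K}
    (hZ : Z * Matrix.single (2 : Fin 3) (0 : Fin 3) (1 : K) = Matrix.single (2 : Fin 3) (0 : Fin 3) 1 * Z) (hZ0 : Z ≠ 0)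
    (htr : Matrix.trace (Matrix.single (0 : Fin 3) (2 : Fin 3) c + Z) = 0) :
    LinearIndependent K ![(1 : Matrix (Fin 3) (Fin 3) K), Matrix.single (0 : Fin 3) (2 : Fin 3) c + Z, (Matrix.single (0 : Fin 3) (2 : Fin 3) c + Z) ^ 2] ∨
      ∃ a b : K, a ≠ b ∧ (Matrix.single (0 : Fin 3) (2 : Fin 3) c + Z - a • (1 : Matrix (Fin 3) (Fin 3) K)) *
          (Matrix.single (0 : Fin 3) (2 : Fin 3) c + Z - b • 1) = 0 ∧
        ∀ a' : K, Matrix.single (0 : Fin 3) (2 : Fin 3) c + Z ≠ a' • 1 := by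
  by_cases hli : LinearIndependent K ![(1 : Matrix (Fin 3) (Fin 3) K), Matrix.single (0 : Fin 3) (2 : Fin 3) c + Z,
      (Matrix.single (0 : Fin 3) (2 : Fin 3) c + Z) ^ 2]
  · exact Or.inl hli
  · obtain ⟨a, b, hab⟩ := (CubicChevalleyDifferential.exists_mul_sub_eq_zero_iff_not_linearIndependent _).2 hli
    obtain ⟨hne, hns⟩ := ne_and_not_scalar_of_slice_nonregular hc h2 h3 hZ hZ0 htr hab
    exact Or.inr ⟨a, b, hne, hab, hns⟩

end Classification

/-! ## §5 The assembly at the vertex `N = c·E₀₂` (modulo the slice identities DOWN ∕ UP of FILE `…HCDSlodowySliceChart`) -/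

section Assembly

variable {K : Type*} [Field K] [ValuativeRel K] [TopologicalSpace K] [IsNonarchimedeanLocalField K]
  (σ : K →+* K) (hσ : ∀ x, σ (σ x) = x) [Invertible (2 : K)] (h3 : (3 : K) ≠ 0)
  {F' : Type*} [Field F'] [ValuativeRel F'] [TopologicalSpace F'] [IsNonarchimedeanLocalField F']
  (ι : F' →+* K) (hι : IsClosedEmbedding ι) (hιr : ∀ x, σ x = x ↔ x ∈ Set.range ι)
  (lam : Kˣ) (hlam : σ lam = -lam)

set_option maxHeartbeats 800000 in
-- long statement (three R2 integrands); elaboration of the subtype coercions dominates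
include hσ ι hι hιr lam hlam h3 in
/-- **ASSEMBLY AT A MINIMAL NILPOTENT `N = c·E₀₂`** (`σ c = −c`, `c ≠ 0`; `J = J₃`; `𝔲₀` trace-free skew, `C = 𝔲₀ ∩ 𝔷(E₂₀)`, any additive Haar measures `μ₀` on `↥𝔲₀`
and `μC` on `↥C`).  HYPOTHESES: the road's local theorems on `↥𝔲₀` in GLOBAL's letters — (i) `hreg` at regular points, (ii) `hss` at semisimple points of type
`(a,a,b)` — and the two slice identities of FILE `…HCDSlodowySliceChart` read as transfers on a neighbourhood `W` of `0` in `↥C`: DOWN (`𝔲₀`-finiteness at `N + Z` ⇒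
`C`-finiteness of `ηι(N + ·)` at `Z`, every `Z ∈ W ∖ {0}`) and UP (`C`-finiteness at `0` ⇒ `𝔲₀`-finiteness at `N`).  CONCLUSION: `ηι` has finite `μ₀`-integral near
`N`.  (§2 with VERTEX = §3, GOOD = §4 + (i)(ii).) [cite: HarishChandra1970, Part VII §1 Thm. 15; Part V §4 Lemma 22] [cite: Slodowy1980, §7.4] -/
theorem exists_nhds_setLIntegral_etaInv_lt_top_of_slice_transfers
    {J : Matrix (Fin 3) (Fin 3) K} (hJ : J = !![0, 0, 1; 0, 1, 0; 1, 0, 0]) {c : K} (hc : σ c = -c) (hc0 : c ≠ 0)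
    (𝔲₀ : AddSubgroup (Matrix (Fin 3) (Fin 3) K)) (h𝔲₀ : ∀ X, X ∈ 𝔲₀ ↔ (X.map σ)ᵀ * J + J * X = 0 ∧ Matrix.trace X = 0)
    [MeasurableSpace ↥𝔲₀] [BorelSpace ↥𝔲₀] (μ₀ : Measure ↥𝔲₀) [μ₀.IsAddHaarMeasure]
    (C : AddSubgroup (Matrix (Fin 3) (Fin 3) K))
    (hC : ∀ X, X ∈ C ↔ ((X.map σ)ᵀ * J + J * X = 0 ∧ Matrix.trace X = 0) ∧
      X * Matrix.single (2 : Fin 3) (0 : Fin 3) (1 : K) = Matrix.single (2 : Fin 3) (0 : Fin 3) 1 * X)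
    [MeasurableSpace ↥C] [BorelSpace ↥C] (μC : Measure ↥C) [μC.IsAddHaarMeasure]
    (hreg : ∀ X₀ : ↥𝔲₀, LinearIndependent K ![(1 : Matrix (Fin 3) (Fin 3) K), (X₀ : Matrix (Fin 3) (Fin 3) K), (X₀ : Matrix (Fin 3) (Fin 3) K) ^ 2] →
      ∃ U ∈ 𝓝 X₀, ∫⁻ X in U, ((NNReal.sqrt (NNReal.sqrt (normAbs K (Matrix.charpoly (X : Matrix (Fin 3) (Fin 3) K)).discr)) : ℝ≥0∞))⁻¹ ∂μ₀ < ∞)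
    (hss : ∀ X₀ : ↥𝔲₀, (∃ a b : K, a ≠ b ∧ ((X₀ : Matrix (Fin 3) (Fin 3) K) - a • (1 : Matrix (Fin 3) (Fin 3) K)) * ((X₀ : Matrix (Fin 3) (Fin 3) K) - b • 1) = 0 ∧
        ∀ a' : K, (X₀ : Matrix (Fin 3) (Fin 3) K) ≠ a' • 1) →
      ∃ U ∈ 𝓝 X₀, ∫⁻ X in U, ((NNReal.sqrt (NNReal.sqrt (normAbs K (Matrix.charpoly (X : Matrix (Fin 3) (Fin 3) K)).discr)) : ℝ≥0∞))⁻¹ ∂μ₀ < ∞)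
    {W : Set ↥C} (hW : W ∈ 𝓝 (0 : ↥C))
    (hdown : ∀ Z ∈ W, Z ≠ 0 → ∀ X₀ : ↥𝔲₀, (X₀ : Matrix (Fin 3) (Fin 3) K) = Matrix.single (0 : Fin 3) (2 : Fin 3) c + (Z : Matrix (Fin 3) (Fin 3) K) →
      (∃ U ∈ 𝓝 X₀, ∫⁻ X in U, ((NNReal.sqrt (NNReal.sqrt (normAbs K (Matrix.charpoly (X : Matrix (Fin 3) (Fin 3) K)).discr)) : ℝ≥0∞))⁻¹ ∂μ₀ < ∞) →
      ∃ U ∈ 𝓝 Z, ∫⁻ Z' in U,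
        ((NNReal.sqrt (NNReal.sqrt (normAbs K (Matrix.charpoly (Matrix.single (0 : Fin 3) (2 : Fin 3) c + (Z' : Matrix (Fin 3) (Fin 3) K))).discr)) : ℝ≥0∞))⁻¹ ∂μC < ∞)
    (hup : (∃ U ∈ 𝓝 (0 : ↥C), ∫⁻ Z' in U,
        ((NNReal.sqrt (NNReal.sqrt (normAbs K (Matrix.charpoly (Matrix.single (0 : Fin 3) (2 : Fin 3) c + (Z' : Matrix (Fin 3) (Fin 3) K))).discr)) : ℝ≥0∞))⁻¹ ∂μC < ∞) →
      ∀ X₀ : ↥𝔲₀, (X₀ : Matrix (Fin 3) (Fin 3) K) = Matrix.single (0 : Fin 3) (2 : Fin 3) c →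
        ∃ U ∈ 𝓝 X₀, ∫⁻ X in U, ((NNReal.sqrt (NNReal.sqrt (normAbs K (Matrix.charpoly (X : Matrix (Fin 3) (Fin 3) K)).discr)) : ℝ≥0∞))⁻¹ ∂μ₀ < ∞) :
    ∀ X₀ : ↥𝔲₀, (X₀ : Matrix (Fin 3) (Fin 3) K) = Matrix.single (0 : Fin 3) (2 : Fin 3) c →
      ∃ U ∈ 𝓝 X₀, ∫⁻ X in U, ((NNReal.sqrt (NNReal.sqrt (normAbs K (Matrix.charpoly (X : Matrix (Fin 3) (Fin 3) K)).discr)) : ℝ≥0∞))⁻¹ ∂μ₀ < ∞ := by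
  subst hJ
  have h2 : (2 : K) ≠ 0 := Invertible.ne_zero 2
  -- `N ∈ 𝔲₀`
  have hNmem : Matrix.single (0 : Fin 3) (2 : Fin 3) c ∈ 𝔲₀ := by
    refine (h𝔲₀ _).2 ⟨(UnitaryThreeWitt.single_zero_two_mem_iff σ c).2 (by rw [hc]; ring), ?_⟩
    exact Matrix.trace_single_eq_of_ne (0 : Fin 3) (2 : Fin 3) c (by decide)
  -- GOOD: every slice point off the vertex is regular or of type `(a,a,b)`, hence covered by (i) ∕ (ii)
  have hgoodU : ∀ Z ∈ W, Z ≠ 0 → ∀ X₀ : ↥𝔲₀, (X₀ : Matrix (Fin 3) (Fin 3) K) = Matrix.single (0 : Fin 3) (2 : Fin 3) c + (Z : Matrix (Fin 3) (Fin 3) K) →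
      ∃ U ∈ 𝓝 X₀, ∫⁻ X in U, ((NNReal.sqrt (NNReal.sqrt (normAbs K (Matrix.charpoly (X : Matrix (Fin 3) (Fin 3) K)).discr)) : ℝ≥0∞))⁻¹ ∂μ₀ < ∞ := by
    intro Z _ hZ0 X₀ hX₀
    obtain ⟨⟨_, hZtr⟩, hZcomm⟩ := (hC _).1 Z.2
    have hZ0' : (Z : Matrix (Fin 3) (Fin 3) K) ≠ 0 := fun h => hZ0 (Subtype.ext h)
    have htr : Matrix.trace (Matrix.single (0 : Fin 3) (2 : Fin 3) c + (Z : Matrix (Fin 3) (Fin 3) K)) = 0 := by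
      rw [Matrix.trace_add, Matrix.trace_single_eq_of_ne (0 : Fin 3) (2 : Fin 3) c (by decide), hZtr, add_zero]
    rcases slice_point_regular_or_type_aab hc0 h2 h3 hZcomm hZ0' htr with hli | ⟨a, b, hab, hprod, hns⟩
    · exact hreg X₀ (by rw [hX₀]; exact hli)
    · exact hss X₀ ⟨a, b, hab, by rw [hX₀]; exact hprod, by rw [hX₀]; exact hns⟩
  -- GOOD on the slice: the `C`-finiteness at every `Z ∈ W ∖ {0}` (DOWN)
  have hgoodC : ∀ Z ∈ W, Z ≠ 0 → ∃ U ∈ 𝓝 Z, ∫⁻ Z' in U,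
      ((NNReal.sqrt (NNReal.sqrt (normAbs K (Matrix.charpoly (Matrix.single (0 : Fin 3) (2 : Fin 3) c + (Z' : Matrix (Fin 3) (Fin 3) K))).discr)) : ℝ≥0∞))⁻¹ ∂μC < ∞ := by
    intro Z hZ hZ0
    obtain ⟨⟨hZskew, hZtr⟩, _⟩ := (hC _).1 Z.2
    have hmem : Matrix.single (0 : Fin 3) (2 : Fin 3) c + (Z : Matrix (Fin 3) (Fin 3) K) ∈ 𝔲₀ :=
      𝔲₀.add_mem hNmem ((h𝔲₀ _).2 ⟨hZskew, hZtr⟩)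
    exact hdown Z hZ hZ0 ⟨_, hmem⟩ rfl (hgoodU Z hZ hZ0 ⟨_, hmem⟩ rfl)
  -- VERTEX on the slice (§3), then UP
  exact hup (exists_nhds_zero_setLIntegral_lt_top_slice σ hσ ι hι hιr lam hlam rfl c C hC μC hW hgoodC)

end Assembly


end Summit.HodgeConjecture.HodgeConjecture.Cruxes.H413.F0P3cStCharTSHCDSlodowySliceAssembly
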